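import Mathlib
import Literature.Probability.LatticeModels.ScalingLimit
import HarnessLib

/-!
# Stub P1 `stub_nonCoincident_pathConnected` for crux `MoebiusLimitExists` (stmt-CriticalPhenomena-1344), line `Sketch` v13
(lead prover-line-stmt-CriticalPhenomena-1344-c18-0; THEOREM-ONLY, `--supports stmt-CriticalPhenomena-1344`)

The configuration space `NonCoincident 3 n` of `n` pairwise distinct points of `ℝ³` is path connected.

Proof (two straight segments through a generic collinear configuration). For a direction
`u : ℝ³` put `m_u := (i ↦ (i : ℝ) • u)`. If `u` is parallel to no difference `x i - x j` (`i ≠ j`)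
of an injective `x`, the whole segment `[x, m_u]` is injective: a coincidence
`(a • x + b • m_u) i = (a • x + b • m_u) j` (`a + b = 1`) reads
`a • (x i - x j) + (b * (i - j)) • u = 0`, and linear independence of `x i - x j, u` forces
`a = 0`, `b = 1`, `i = j`. A direction `u` avoiding the finitely many lines spanned by the
differences of two configurations `x, y` exists because every line of `ℝ³` is Lebesgue-null
(`Measure.addHaar_submodule`), so finitely many lines do not cover `ℝ³`; then
`x ~ m_u ~ y` inside `NonCoincident 3 n` (`JoinedIn.of_segment_subset`, `JoinedIn.trans`).
Mathlib only.
-/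

noncomputable section

open Set Function MeasureTheory
open Literature.Probability.LatticeModels

namespace Summit.CriticalPhenomena.Ising3DConformalLimit.MoebiusLimitExistsSketchV13

/-- A line `ℝ ∙ v` is a strict subspace of `ℝ³` (its `finrank` is `≤ 1 < 3`). [folklore] -/
private theorem span_singleton_ne_top (v : EuclideanSpace ℝ (Fin 3)) :
    Submodule.span ℝ ({v} : Set (EuclideanSpace ℝ (Fin 3))) ≠ ⊤ :=
  (span_lt_top_of_card_lt_finrank (R := ℝ) (s := ({v} : Set (EuclideanSpace ℝ (Fin 3))))
    (by simp)).ne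

/-- `ℝ³` is not covered by finitely many lines through the origin: each line is a strict
subspace, hence Lebesgue-null (`Measure.addHaar_submodule`), and so is a finite union of them,
whereas `ℝ³` itself has positive measure. [folklore] -/
private theorem exists_forall_not_mem_span {ι : Type*} [Finite ι]
    (d : ι → EuclideanSpace ℝ (Fin 3)) :
    ∃ u : EuclideanSpace ℝ (Fin 3),
      ∀ k, u ∉ Submodule.span ℝ ({d k} : Set (EuclideanSpace ℝ (Fin 3))) := by
  by_contra h
  push Not at h
  have hU : (⋃ k, (Submodule.span ℝ ({d k} : Set (EuclideanSpace ℝ (Fin 3))) :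
      Set (EuclideanSpace ℝ (Fin 3)))) = Set.univ :=
    Set.eq_univ_of_forall fun u => Set.mem_iUnion.2 (h u)
  have h0 : volume (⋃ k, (Submodule.span ℝ ({d k} : Set (EuclideanSpace ℝ (Fin 3))) :
      Set (EuclideanSpace ℝ (Fin 3)))) = 0 :=
    measure_iUnion_null fun k => Measure.addHaar_submodule _ _ (span_singleton_ne_top (d k))
  rw [hU] at h0
  exact isOpen_univ.measure_ne_zero volume univ_nonempty h0

/-- The straight segment from a non-coincident configuration `x` to the collinear configuration
`i ↦ (i : ℝ) • u` stays inside `NonCoincident 3 n` as soon as `u` lies on none of the lines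
`ℝ ∙ (x i - x j)`, `i ≠ j`: a coincidence `(a • x + b • m_u) i = (a • x + b • m_u) j` with
`a + b = 1` reads `a • (x i - x j) + (b * (i - j)) • u = 0`, so `a = 0`, `b = 1`, `i = j`.
[folklore] -/
private theorem segment_subset_nonCoincident {n : ℕ} {x : Fin n → EuclideanSpace ℝ (Fin 3)}
    (hx : x ∈ NonCoincident 3 n) {u : EuclideanSpace ℝ (Fin 3)}
    (hu : ∀ i j : Fin n, i ≠ j →
      u ∉ Submodule.span ℝ ({x i - x j} : Set (EuclideanSpace ℝ (Fin 3)))) :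
    segment ℝ x (fun i : Fin n => ((i : ℕ) : ℝ) • u) ⊆ NonCoincident 3 n := by
  rintro z ⟨a, b, -, -, hab, rfl⟩
  rw [mem_nonCoincident] at hx ⊢
  intro i j hij
  by_contra hne
  have hli : LinearIndependent ℝ ![x i - x j, u] := by
    rw [LinearIndependent.pair_iff' (sub_ne_zero.2 (hx.ne hne))]
    intro s hs
    exact hu i j hne (Submodule.mem_span_singleton.2 ⟨s, hs⟩)
  have key : a • (x i - x j) + (b * (((i : ℕ) : ℝ) - ((j : ℕ) : ℝ))) • u = 0 := by
    have h := hij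
    simp only [Pi.add_apply, Pi.smul_apply] at h
    linear_combination (norm := module) h
  obtain ⟨ha, hb⟩ := LinearIndependent.pair_iff.1 hli _ _ key
  rw [ha, zero_add] at hab
  rw [hab, one_mul, sub_eq_zero] at hb
  exact hne (Fin.ext (Nat.cast_injective hb))

/-- Any two non-coincident configurations `x, y` are joined inside `NonCoincident 3 n`: pick a
direction `u` off the finitely many lines `ℝ ∙ (x i - x j)`, `ℝ ∙ (y i - y j)` and go
`x → (i ↦ (i : ℝ) • u) → y` along two straight segments. [folklore] -/
private theorem joinedIn_nonCoincident {n : ℕ} {x y : Fin n → EuclideanSpace ℝ (Fin 3)}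
    (hx : x ∈ NonCoincident 3 n) (hy : y ∈ NonCoincident 3 n) :
    JoinedIn (NonCoincident 3 n) x y := by
  obtain ⟨u, hu⟩ := exists_forall_not_mem_span
    (Sum.elim (fun p : Fin n × Fin n => x p.1 - x p.2) (fun p : Fin n × Fin n => y p.1 - y p.2))
  have hxm : JoinedIn (NonCoincident 3 n) x (fun i : Fin n => ((i : ℕ) : ℝ) • u) :=
    JoinedIn.of_segment_subset
      (segment_subset_nonCoincident hx fun i j _ => hu (Sum.inl (i, j)))
  have hym : JoinedIn (NonCoincident 3 n) y (fun i : Fin n => ((i : ℕ) : ℝ) • u) :=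
    JoinedIn.of_segment_subset
      (segment_subset_nonCoincident hy fun i j _ => hu (Sum.inr (i, j)))
  exact hxm.trans hym.symm

/-- **Stub P1 — `stub_nonCoincident_pathConnected`** (registered signature): the configuration
space of `n` pairwise distinct points of `ℝ³` is path connected. Base point: the collinear
configuration `i ↦ (i : ℝ) • u` for some `u ≠ 0` (injective since `i ↦ (i : ℝ)` is); every
non-coincident configuration is joined to it by `joinedIn_nonCoincident`. [folklore] -/
theorem stub_nonCoincident_pathConnected : ∀ n : ℕ, IsPathConnected (NonCoincident 3 n) := by
  intro n
  obtain ⟨u, hu⟩ :=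
    exists_forall_not_mem_span fun _ : Unit => (0 : EuclideanSpace ℝ (Fin 3))
  have hu0 : u ≠ 0 := by
    have h : u ∉ Submodule.span ℝ ({0} : Set (EuclideanSpace ℝ (Fin 3))) := hu ()
    rwa [Submodule.span_zero_singleton, Submodule.mem_bot] at h
  have hm : (fun i : Fin n => ((i : ℕ) : ℝ) • u) ∈ NonCoincident 3 n := by
    rw [mem_nonCoincident]
    intro i j hij
    exact Fin.ext (Nat.cast_injective (R := ℝ) (smul_left_injective ℝ hu0 hij))
  exact ⟨_, hm, fun y hy => joinedIn_nonCoincident hm hy⟩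

end Summit.CriticalPhenomena.Ising3DConformalLimit.MoebiusLimitExistsSketchV13

end
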